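import Summits.HodgeConjecture.HodgeConjecture.Theses.HeckePrymWeil
import Summits.HodgeConjecture.HodgeConjecture.Theorems.HeckePrymWeilLadderGlue
import Summits.HodgeConjecture.HodgeConjecture.Theorems.HeckePrymWeilWeilVariationalHodgeReductions

/-!
# Route HeckePrymWeil — the ladder glue with `WeilVariationalHodge` replaced by its engine-typed core

`LadderGlue` (stmt-HodgeConjecture-14499, proved: `heckePrymWeil_ladderGlue_proof`) is
`HeckePrymAnchors → WeilVariationalHodge → IsoInvariance → ProductDescent → WeilDescending → HodgeWeilLadder`.
The crux `WeilVariationalHodge` (stmt-HodgeConjecture-14497) AS TYPED is Grothendieck's variational Hodge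
statement along smooth PROPER families over arbitrary smooth irreducible bases, while every printed engine
addresses H-PROJECTIVE families; `weilRung_quasiProjective_iff_core`
(`Theorems/HeckePrymWeilWeilVariationalHodgeReductions.lean`) shows that the crux restricted to families with
QUASI-PROJECTIVE TOTAL SPACE is equivalent to that engine-typed core. This file checks that the route still
closes after the corresponding restatement of BOTH family items:

* `heckePrymWeil_ladderGlue_of_quasiProjectiveAnchors_of_core` —
  `HeckePrymAnchors⁺ → Core → IsoInvariance → ProductDescent → WeilDescending → HodgeWeilLadder`, where
  `HeckePrymAnchors⁺` is `HeckePrymAnchors` with the single extra conjunct `IsQuasiProjectiveOver 𝒳` on the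
  anchored family it produces (universal families over quasi-projective fine moduli schemes have
  quasi-projective total space), and `Core` is the Weil rung for H-projective families over smooth
  irreducible affine bases, for all `p ≡ 3 (4)` prime `≥ 7` and `M ≥ 1`.

Same ℕ-bookkeeping as `heckePrymWeil_ladderGlue_proof` (`heckePrymWeil_ladder_glue_logic`); the only change
is that algebraicity at the anchored fibre `s₁` comes from `weilRung_quasiProjective_of_core`.
-/

-- every declaration of this problem lives in `Summit.HodgeConjecture.HodgeConjecture.…` (summit = sub-problem)
set_option linter.dupNamespace false

open CategoryTheory AlgebraicGeometry MonoidalCategory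
open Literature.AlgebraicGeometry.Motives Literature.AlgebraicGeometry.HodgeTheory

namespace Summit.HodgeConjecture.HodgeConjecture.Theorems

open Summit.HodgeConjecture.HodgeConjecture.Theses.HeckePrymWeil

/-- **Ladder glue with the engine-typed core.** If `HeckePrymAnchors` is strengthened by asking the
anchored family it produces to have quasi-projective total space (`HeckePrymAnchors⁺`, first hypothesis,
verbatim `HeckePrymAnchors` with the extra conjunct `IsQuasiProjectiveOver 𝒳`), then the engine-typed core
of `WeilVariationalHodge` (the Weil rung for H-projective families over smooth irreducible affine bases,
second hypothesis) replaces the crux as typed in the glue: for the rung `(p, g)` run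
`heckePrymWeil_ladder_glue_logic` with step `(p - 1) / 2`, descent `WeilDescending`, top rung
`ProductDescent` at `n₀` fed by the anchored families of `HeckePrymAnchors⁺` at `(p, g + 1)`, made
algebraic at the anchored fibre by `weilRung_quasiProjective_of_core` and transported by `IsoInvariance`.
[folklore] -/
theorem heckePrymWeil_ladderGlue_of_quasiProjectiveAnchors_of_core
    (hA : ∀ p : ℕ, p.Prime → p % 4 = 3 → 7 ≤ p → ∀ g : ℕ, 2 ≤ g → ∀ n k : ℕ, k = n + 1 → k = (p - 1) / 2 * (g - 1) → ∀ (A : AbelianVariety ℂ) (φ : A ⟶ A), A.dim = (2 * n) → CategoryStruct.comp φ φ = -((p : ℤ) • CategoryStruct.id A) → ∃ (B : AbelianVariety ℂ) (ψ : B ⟶ B), B.dim = 2 ∧ CategoryStruct.comp ψ ψ = -((p : ℤ) • CategoryStruct.id B) ∧ (∃ b : complexBetti B.X (2 * 1), b ≠ 0 ∧ IsRationalClass b ∧ IsOfHodgeType (2 * 1) B.X (2 * 1) 1 1 b ∧ b ∈ Module.End.eigenspace (complexBetti.map (CategoryStruct.id B + ψ).hom.hom.hom (2 * 1)).hom ((1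 + Complex.I * (Real.sqrt (p : ℝ) : ℂ)) ^ (2 * 1)) ⊔ Module.End.eigenspace (complexBetti.map (CategoryStruct.id B + ψ).hom.hom.hom (2 * 1)).hom ((1 - Complex.I * (Real.sqrt (p : ℝ) : ℂ)) ^ (2 * 1))) ∧ ∀ c : complexBetti (A.prod B).X (2 * k), IsRationalClass c → IsOfHodgeType (2 * k) (A.prod B).X (2 * k) k k c → c ∈ Module.End.eigenspace (complexBetti.map (CategoryStruct.id (A.prod B) + (AbelianVariety.prodLift (CategoryStruct.comp (AbelianVariety.fst A B) φ) (CategoryStruct.comp (AbelianVariety.snd A B) ψ))).hom.hom.hom (2 * k)).hom ((1 + Complex.I * (Real.sqrt (p : ℝ) : ℂ)) ^ (2 * k)) ⊔ Module.End.eigenspace (complexBetti.map (CategoryStruct.id (A.prod B) + (AbelianVariety.prodLift (CategoryStruct.comp (AbelianVariety.fst A B) φ) (CategoryStruct.comp (AbelianVariety.snd A B) ψ))).hom.hom.hom (2 * k)).hom ((1 - Complex.I * (Real.sqrt (p : ℝ) : ℂ)) ^ (2 * k)) → ∃ (𝒳 S : SchemeOver ℂ) (f : 𝒳 ⟶ S)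 (s₁ s₀ : ComplexPoints S) (e : (A.prod B).X ≅ fiberOver f s₁) (W : complexBetti 𝒳 (2 * k)), IsSmoothProjectiveFamily f (2 * k) ∧ IsQuasiProjectiveOver 𝒳 ∧ IrreducibleSpace S.left ∧ AlgebraicGeometry.Smooth S.hom ∧ (∀ s : ComplexPoints S, IsRationalClass (complexBetti.map (fiberι f s) (2 * k) W) ∧ IsOfHodgeType (2 * k) (fiberOver f s) (2 * k) k k (complexBetti.map (fiberι f s) (2 * k) W)) ∧ (∀ s : ComplexPoints S, ∃ (A' : AbelianVariety ℂ) (φ' : A' ⟶ A'), A'.dim = (2 * k) ∧ CategoryStruct.comp φ' φ' = -((p : ℤ) • CategoryStruct.id A') ∧ Nonempty (A'.X ≅ fiberOver f s)) ∧ complexBetti.map e.hom (2 * k) (complexBetti.map (fiberι f s₁) (2 * k) W) = c ∧ (complexBetti.map (fiberι f s₀) (2 * k) W) ∈ algebraicClasses (fiberOver f s₀) k)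
    (hcore : ∀ p : ℕ, p.Prime → p % 4 = 3 → 7 ≤ p → ∀ M : ℕ, 1 ≤ M →
      ∀ ⦃𝒳 S : SchemeOver ℂ⦄ (f : 𝒳 ⟶ S), IsSmoothProjectiveFamily f (2 * M) →
      (∃ (N : ℕ) (ι : 𝒳 ⟶ projectiveSpace N ℂ ⊗ S), IsClosedImmersion ι.left ∧
        ι ≫ CartesianMonoidalCategory.snd (projectiveSpace N ℂ) S = f) →
      IrreducibleSpace S.left → IsAffine S.left → AlgebraicGeometry.Smooth S.hom →
      ∀ (W : complexBetti 𝒳 (2 * M)),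
      (∀ s : ComplexPoints S, IsRationalClass (complexBetti.map (fiberι f s) (2 * M) W) ∧
        IsOfHodgeType (2 * M) (fiberOver f s) (2 * M) M M (complexBetti.map (fiberι f s) (2 * M) W)) →
      (∀ s : ComplexPoints S, ∃ (A' : AbelianVariety ℂ) (φ' : A' ⟶ A'), A'.dim = (2 * M) ∧
        φ' ≫ φ' = -((p : ℤ) • 𝟙 A') ∧ Nonempty (A'.X ≅ fiberOver f s)) →
      (∃ s₀ : ComplexPoints S, complexBetti.map (fiberι f s₀) (2 * M) W ∈ algebraicClasses (fiberOver f s₀) M) →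
      ∀ s : ComplexPoints S, complexBetti.map (fiberι f s) (2 * M) W ∈ algebraicClasses (fiberOver f s) M)
    (hI : IsoInvariance) (hP : ProductDescent) (hD : WeilDescending) : HodgeWeilLadder := by
  unfold HodgeWeilLadder
  intro p hp hp4 hp7
  refine heckePrymWeil_ladder_glue_logic _ ((p - 1) / 2) (by omega) ?_ (hD p hp hp4 hp7)
  intro g hg n₀ hn₀
  -- `n₀ ≥ 5`: the step is `≥ 3` and `g ≥ 2`
  have h6 : 3 * 2 ≤ (p - 1) / 2 * g := Nat.mul_le_mul (by omega) hg
  have hk : n₀ + 1 = (p - 1) / 2 * (g + 1 - 1) := by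
    rw [Nat.add_sub_cancel]
    exact hn₀
  refine hP p hp hp4 hp7 n₀ (by omega) ?_
  intro A φ hdim hφ
  obtain ⟨B, ψ, hB, hψ, hb, hfam⟩ :=
    hA p hp hp4 hp7 (g + 1) (by omega) n₀ (n₀ + 1) rfl hk A φ hdim hφ
  refine ⟨B, ψ, hB, hψ, hb, fun c hc hH hW => ?_⟩
  obtain ⟨𝒳, S, f, s₁, s₀, e, W, hsm, hqp, hirr, hS, hWs, hfib, he, halg⟩ := hfam c hc hH hW
  have h₁ := weilRung_quasiProjective_of_core (hcore p hp hp4 hp7 (n₀ + 1) (by omega)) f hsm hqp hirr hS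
    W hWs hfib ⟨s₀, halg⟩ s₁
  rw [← he]
  exact hI e (n₀ + 1) _ h₁

/-- **Ladder glue with `HeckePrymAnchors` as typed, the core, and para-abelian quasi-projectivity.** Keeping
the anchor item unchanged, the crux as typed is recovered from the engine-typed core granted `hqp`
(quasi-projectivity of total spaces of smooth proper families with abelian complex fibres over smooth
irreducible affine bases, `weilVariationalHodge_of_projectiveCore`), and the landed glue
`heckePrymWeil_ladderGlue_proof` applies. [folklore] -/
theorem heckePrymWeil_ladderGlue_of_core_of_paraAbelianQuasiProjective (hA : HeckePrymAnchors)
    (hqp : ∀ (M : ℕ) ⦃𝒳 S : SchemeOver ℂ⦄ (f : 𝒳 ⟶ S), IsSmoothProjectiveFamily f (2 * M) →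
      IrreducibleSpace S.left → IsAffine S.left → AlgebraicGeometry.Smooth S.hom →
      (∀ s : ComplexPoints S, ∃ A' : AbelianVariety ℂ, Nonempty (A'.X ≅ fiberOver f s)) →
      IsQuasiProjectiveOver 𝒳)
    (hcore : ∀ p : ℕ, p.Prime → p % 4 = 3 → 7 ≤ p → ∀ M : ℕ, 1 ≤ M →
      ∀ ⦃𝒳 S : SchemeOver ℂ⦄ (f : 𝒳 ⟶ S), IsSmoothProjectiveFamily f (2 * M) →
      (∃ (N : ℕ) (ι : 𝒳 ⟶ projectiveSpace N ℂ ⊗ S), IsClosedImmersion ι.left ∧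
        ι ≫ CartesianMonoidalCategory.snd (projectiveSpace N ℂ) S = f) →
      IrreducibleSpace S.left → IsAffine S.left → AlgebraicGeometry.Smooth S.hom →
      ∀ (W : complexBetti 𝒳 (2 * M)),
      (∀ s : ComplexPoints S, IsRationalClass (complexBetti.map (fiberι f s) (2 * M) W) ∧
        IsOfHodgeType (2 * M) (fiberOver f s) (2 * M) M M (complexBetti.map (fiberι f s) (2 * M) W)) →
      (∀ s : ComplexPoints S, ∃ (A' : AbelianVariety ℂ) (φ' : A' ⟶ A'), A'.dim = (2 * M) ∧
        φ' ≫ φ' = -((p : ℤ) • 𝟙 A') ∧ Nonempty (A'.X ≅ fiberOver f s)) →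
      (∃ s₀ : ComplexPoints S, complexBetti.map (fiberι f s₀) (2 * M) W ∈ algebraicClasses (fiberOver f s₀) M) →
      ∀ s : ComplexPoints S, complexBetti.map (fiberι f s) (2 * M) W ∈ algebraicClasses (fiberOver f s) M)
    (hI : IsoInvariance) (hP : ProductDescent) (hD : WeilDescending) : HodgeWeilLadder :=
  heckePrymWeil_ladderGlue_proof hA (weilVariationalHodge_of_projectiveCore hqp hcore) hI hP hD

end Summit.HodgeConjecture.HodgeConjecture.Theorems
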